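import Mathlib.Data.Matrix.Mul
import Mathlib.Data.Fintype.BigOperators
import Mathlib.Algebra.Order.BigOperators.Group.Finset
import Mathlib.Algebra.Order.Ring.Abs
import Mathlib.InformationTheory.Hamming
import Mathlib.Tactic.Ring
import Mathlib.Tactic.Linarith
import Mathlib.Tactic.Positivity
import Mathlib.Tactic.GCongr
import Mathlib.Tactic.Push
import Literature.Algebra.EuclideanLattices.IntegerBases
import HarnessLib

/-!
# Khot 2005, §§6–7: augmented tensor powers of lattices and the boosting Lemmas 7.1, 7.2 (Euclidean norm)

Topic `Algebra/EuclideanLattices`, namespace `Literature.Algebra.EuclideanLattices` with the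
paper sub-namespace `Khot` for Khot's constructions. Second brick (after
`KhotSVPHardness.lean`) of the decomposition of the named fact
`Literature.Algebra.EuclideanLattices.gapSVP_const_isNPHardRandomized` (`LatticeComplexity.lean`,
pqc.S17: constant-factor `GapSVP` is NP-hard under randomised reductions) through
`Literature.Algebra.EuclideanLattices.Khot2005_SAT_randReducible_gapSVP` (Khot, J. ACM 52 (2005),
Thm. 1.1, proved in §7.3 as SAT →(Thm. 3.1) CVP →(Thm. 5.1) SVP →(§§6–7) `GapSVP`). This file
PROVES the last arrow — the pure lattice mathematics of §6 (augmented tensor product) and §7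
(Lemma 7.1, the YES case; Lemma 7.2, the NO case; §7.3, the gap) — for the Euclidean norm
`p = 2` (the tree's lattices are Euclidean, `Problems.lean`), in exact integer arithmetic.

## Contents

* `intSqNorm v = ∑ᵢ vᵢ²` (the integer `‖v‖₂²` of an integer vector; `norm_intVecToEuclidean_sq`
  links it to the Euclidean norm of `IntegerBases.lean`) and its elementary estimates against
  Mathlib's `hammingNorm` (number of nonzero coordinates): each nonzero integer coordinate
  contributes `≥ 1`, each nonzero even one `≥ 4`.
* `Khot.Coef n j`, `Khot.Out m n j`: index types of coefficient vectors / lattice vectors of the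
  `j`-fold augmented tensor power `L_{j+1}` (§6.2), defined by recursion on `j` (reducible).
* `Khot.augPow B W j`: the basis map of `W · L_{j+1}` for `L = L(B)`, `B ∈ ℤ^{m×n}` (Khot's
  column convention `L(B) = {Bx}`, §1.3) and `α = 1/W` (§6.2 and §7 Eq. (2)); `Khot.tpow x j`:
  the tensor power `x^{⊗(j+1)}` (§7.1); `Khot.NoStructure B d D`: the NO-structure of Thm. 5.1 (3).
* PROVED: homogeneity and injectivity of `augPow` (`augPow_smul`, `augPow_eq_zero`), the norm
  recursion of the proof of Lemma 7.1 (`intSqNorm_augPow_tpow_succ`), **Lemma 7.1**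
  (`intSqNorm_augPow_tpow_le`, `short_vector_of_yes`), **Lemma 7.2**
  (`le_intSqNorm_augPow`), and the two bounds side by side (`boosted_gap`, §7.3).

## The source, as printed (Khot, J. ACM 52 (2005) 789–808), and the rendering

* §6.2 (p. 804): "The augmented tensor product `L ⊗_{αA} L'` with parameter `α > 0` …
  `{αBx_1 ∘ αBx_2 ∘ ⋯ ∘ αBx_{N'} ∘ BxB'ᵀ | x ∈ ℤ^{NN'}}` … Alternatively … basis
  `B ⊗ [αI ; B']`." §7 (p. 804): "`α = 1/d^{10k}` … `L_1 = L`, `L_j = L ⊗_{αA} L_{j-1}` (2)."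
* Lemma 7.1 (p. 805): "For `1 ≤ j ≤ k`, `‖B_j x^{⊗j}‖ₚᵖ ≤ ∑_{l=1}^j γˡdˡ`. In particular, the
  lattice `L_k` has a nonzero lattice vector of length `(2γᵏdᵏ)^{1/p}`, namely the vector
  `B_k x^{⊗k}`", for `x` with "`‖Bx‖ₚᵖ ≤ γd`, `‖x‖ₚᵖ ≤ d^{10p}`" (Thm. 5.1 (2)); proof:
  "`‖B_j x^{⊗j}‖ₚᵖ = ‖Bx‖ₚᵖ · (αᵖ ‖x^{⊗(j-1)}‖ₚᵖ + ‖B_{j-1}x^{⊗(j-1)}‖ₚᵖ)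
  ≤ γd αᵖ d^{10p(j-1)} + γd ∑_{l=1}^{j-1} γˡdˡ ≤ ∑_{l=1}^j γˡdˡ`."
* Lemma 7.2 (p. 805): "For `1 ≤ j ≤ k`, the length of any nonzero vector in the lattice `L_j` is
  at least `d^{j/p}`", for `B` such that every nonzero `Bx` "either has `d` nonzero co-ordinates,
  or has all co-ordinates even and at least `d/2ᵖ` of them are nonzero, or has one co-ordinate
  with magnitude at least `d^{20k}`" (Thm. 5.1 (3)); proof by Cases 1–3 (pp. 805–806).
* §7.3 (p. 806): "Lemmas 7.1 and 7.2 imply that `L_k` is a gap instance of SVP with gap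
  `(1/(2γᵏ))^{1/p} = 2^{Ω(k)}`."

Rendering. (i) `p = 2`; `d/2ᵖ = d/4` is rendered exactly as `d ≤ 4 · #{nonzero}`. (ii) The
real parameter `α = 1/d^{10k} < 1` is cleared: `augPow B W j` is the basis map of the INTEGER
lattice `W · L_{j+1}` with `W = 1/α` (level `0`: `x ↦ W·Bx`; level `j+1`: side block `Bx`,
main block the rows of `Bx` through level `j` — multiply the printed vector by `W`), so every
norm is the printed one times `W` and the gap is untouched; the printed inequalities
`αᵖ‖x^{⊗(j-1)}‖ₚᵖ ≤ 1` and `αᵖd^{20kp} ≥ d^{kp}` become the hypotheses `s^k ≤ W²` and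
`W² d^{j+1} ≤ D²` on abstract parameters `s` (`‖x‖² ≤ s`), `g` (`‖Bx‖² ≤ g`, printed `γd`),
`d`, `D` (printed `d^{20k}`), which the assembly (Thm. 5.1 with `N = d^{42C''k/η}`) instantiates.
(iii) Level `j` here is Khot's `L_{j+1}`. (iv) "`∑_{l=1}^k γˡdˡ ≤ 2γᵏdᵏ`" needs `γd ≥ 2`
(`sum_pow_le_two_mul_pow`, hypothesis `2 ≤ g`). (v) Khot's bases have independent columns
(§1.3); this is the hypothesis `Bx = 0 → x = 0`, used for nonvanishing (YES) and for Case 2/3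
of Lemma 7.2 (nonzero rows have nonzero images).

## What is NOT here (remaining bricks, see the tenure NOTES.md)

Thm. 3.1 (CVP instance from gap Exact Set Cover; its PCP-based input is a named fact to be
vendored), Thm. 4.1 (BCH codes), Lemmas 4.2–4.3, 5.4–5.8 (the basic reduction, Thm. 5.1), the
final threshold and the `ℓ₂` padding of the `M × N` basis to a square nonsingular one (reading
convention 1 of `KhotSVPHardness.lean`), and the machine-level (`RandAlg.IsPolyTime`) assembly of
`Khot2005_SAT_randReducible_gapSVP`. No tensor product of general lattices beyond what §7 uses.

## References

* S. Khot, *Hardness of approximating the shortest vector problem in lattices*, J. ACM 52 (2005)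
  789–808: §1.3, Thm. 5.1, §6.1–6.2, §7 (Eq. (2), Lemma 7.1, Lemma 7.2 with Eq. (3), §7.3).
* D. Micciancio, S. Goldwasser, *Complexity of Lattice Problems*, Kluwer 2002, Ch. 1 §1
  (Euclidean norm of integer vectors).
-/

namespace Literature.Algebra.EuclideanLattices

open Matrix Finset

/-! ### Squared Euclidean norm and number of nonzero coordinates of an integer vector -/

section IntVec

variable {ι : Type} [Fintype ι]

/-- The squared Euclidean norm `‖v‖² = ∑ᵢ vᵢ²` of an integer vector, as an integer (exact
arithmetic; `‖Bx‖ₚᵖ` of Khot 2005 for `p = 2`). [cite: Khot2005, §1.3] -/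
def intSqNorm (v : ι → ℤ) : ℤ := ∑ i, v i ^ 2

/-- `‖v‖² ≥ 0`. [folklore] -/
theorem intSqNorm_nonneg (v : ι → ℤ) : 0 ≤ intSqNorm v :=
  sum_nonneg fun i _ => sq_nonneg (v i)

/-- A single coordinate: `vᵢ² ≤ ‖v‖²`. [folklore] -/
theorem sq_le_intSqNorm (v : ι → ℤ) (i : ι) : v i ^ 2 ≤ intSqNorm v :=
  single_le_sum (f := fun i => v i ^ 2) (fun i _ => sq_nonneg (v i)) (mem_univ i)

/-- `‖c·v‖² = c²‖v‖²`. [folklore] -/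
theorem intSqNorm_smul (c : ℤ) (v : ι → ℤ) : intSqNorm (c • v) = c ^ 2 * intSqNorm v := by
  simp only [intSqNorm, Pi.smul_apply, smul_eq_mul, mul_pow, mul_sum]

/-- Each nonzero (integer!) coordinate contributes at least `1` to `‖v‖²`: the number of nonzero
coordinates (Mathlib's `hammingNorm`) is at most `‖v‖²` (used in Khot 2005, §7.2: "every nonzero vector in `L(B)` has length at least `d^{1/p}`"). [cite: Khot2005, §7.2] -/
theorem hammingNorm_le_intSqNorm (v : ι → ℤ) : (hammingNorm v : ℤ) ≤ intSqNorm v := by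
  classical
  unfold hammingNorm intSqNorm
  rw [card_eq_sum_ones, Nat.cast_sum]
  calc ∑ i ∈ univ.filter (fun i => v i ≠ 0), ((1 : ℕ) : ℤ)
      ≤ ∑ i ∈ univ.filter (fun i => v i ≠ 0), v i ^ 2 :=
        sum_le_sum fun i hi => by
          have hi' : v i ≠ 0 := (mem_filter.1 hi).2
          simpa using (one_le_sq_iff_one_le_abs _).2 (Int.one_le_abs hi')
    _ ≤ ∑ i, v i ^ 2 :=
        sum_le_sum_of_subset_of_nonneg (filter_subset _ _) fun i _ _ => sq_nonneg (v i)

/-- Each nonzero EVEN coordinate contributes at least `4 = 2ᵖ` to `‖v‖²` (Khot 2005, §7.2, Case 3). [cite: Khot2005, §7.2] -/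
theorem four_mul_hammingNorm_le_intSqNorm (v : ι → ℤ) (h : ∀ i, Even (v i)) :
    4 * (hammingNorm v : ℤ) ≤ intSqNorm v := by
  classical
  unfold hammingNorm intSqNorm
  rw [card_eq_sum_ones, Nat.cast_sum, mul_sum]
  calc ∑ i ∈ univ.filter (fun i => v i ≠ 0), 4 * ((1 : ℕ) : ℤ)
      ≤ ∑ i ∈ univ.filter (fun i => v i ≠ 0), v i ^ 2 :=
        sum_le_sum fun i hi => by
          have hi' : v i ≠ 0 := (mem_filter.1 hi).2
          obtain ⟨t, ht⟩ := h i
          have ht0 : t ≠ 0 := by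
            rintro rfl
            exact hi' (by simpa using ht)
          have h1 : 1 ≤ t ^ 2 := (one_le_sq_iff_one_le_abs _).2 (Int.one_le_abs ht0)
          rw [ht]
          push_cast
          nlinarith
    _ ≤ ∑ i, v i ^ 2 :=
        sum_le_sum_of_subset_of_nonneg (filter_subset _ _) fun i _ _ => sq_nonneg (v i)

/-- A nonzero integer vector has `‖v‖² ≥ 1`. [folklore] -/
theorem one_le_intSqNorm {v : ι → ℤ} (hv : v ≠ 0) : 1 ≤ intSqNorm v := by
  classical
  have h := hammingNorm_pos_iff.2 hv
  have := hammingNorm_le_intSqNorm v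
  omega

/-- `‖f ∘ g‖² = ‖f‖² + ‖g‖²` for a concatenation (Khot's `∘`, §6.2). [folklore] -/
theorem intSqNorm_sum_elim {κ : Type} [Fintype κ] (f : ι → ℤ) (g : κ → ℤ) :
    intSqNorm (Sum.elim f g) = intSqNorm f + intSqNorm g :=
  Fintype.sum_sum_type _

/-- The squared norm of a matrix (Frobenius) is the sum of the squared norms of its rows. [folklore] -/
theorem intSqNorm_prod {κ : Type} [Fintype κ] (f : ι × κ → ℤ) :
    intSqNorm f = ∑ i, intSqNorm fun k => f (i, k) :=
  Fintype.sum_prod_type _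

/-- `‖u ⊗ v‖² = ‖u‖² ‖v‖²` for an outer product (Khot 2005, §7.1: `‖x^{⊗j}‖ₚᵖ = ‖x‖ₚ^{pj}`). [folklore] -/
theorem intSqNorm_outer {κ : Type} [Fintype κ] (u : ι → ℤ) (v : κ → ℤ) :
    intSqNorm (fun p : ι × κ => u p.1 * v p.2) = intSqNorm u * intSqNorm v := by
  simp only [intSqNorm, Fintype.sum_prod_type, mul_pow, ← mul_sum, ← sum_mul]

/-- Bridge to the Euclidean norm of `IntegerBases.lean`: `‖v‖² = intSqNorm v` for `v ∈ ℤᴺ`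
viewed in `ℝᴺ` through `intVecToEuclidean`. [cite: MicciancioGoldwasser2002, Ch. 1 §1] -/
theorem norm_intVecToEuclidean_sq (N : ℕ) (v : Fin N → ℤ) :
    ‖intVecToEuclidean N v‖ ^ 2 = (intSqNorm v : ℝ) := by
  rw [norm_intVecToEuclidean, Real.sq_sqrt (sum_nonneg fun j _ => sq_nonneg _), intSqNorm]
  push_cast
  rfl

end IntVec

/-! ### Khot's augmented tensor powers (§6.2, §7) -/

namespace Khot

section Defs

variable {m n : Type}

/-- Index type of the COEFFICIENT vectors of Khot's `j`-fold augmented tensor power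
`L_{j+1}` of a lattice with basis `B ∈ ℤ^{m × n}` (columns indexed by `n`): level `0` is `n`
(the lattice `L_1 = L(B)` itself), and a coefficient vector of `L_{j+2} = L ⊗_A L_{j+1}` is an
`n × (coefficients of L_{j+1})` integer matrix `x = [x_1 ⋯ x_{N'}]` (Khot 2005, §6.2).
Reducible, so that level `j+1` unfolds to the product type. [cite: Khot2005, §6.2] -/
@[reducible] def Coef (n : Type) : ℕ → Type
  | 0 => n
  | j + 1 => n × Coef n j

/-- Index type of the lattice VECTORS (coordinates) of Khot's `j`-fold augmented tensor power
`L_{j+1}`: level `0` is `m` (vectors `Bx`), and a vector of `L ⊗_A L_{j+1}` is the concatenation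
`αBx_1 ∘ ⋯ ∘ αBx_{N'} ∘ B x B_{j+1}ᵀ` — a block indexed by `m × (coefficients of L_{j+1})`
followed by a block indexed by `m × (coordinates of L_{j+1})` (Khot 2005, §6.2: "the lattice
vectors in the augmented tensor product have `MN' + MM'` co-ordinates"). [cite: Khot2005, §6.2] -/
@[reducible] def Out (m n : Type) : ℕ → Type
  | 0 => m
  | j + 1 => (m × Coef n j) ⊕ (m × Out m n j)

/-- `Coef n j` is a finite type. [cite: Khot2005, §6.2] -/
instance instFintypeCoef [Fintype n] : (j : ℕ) → Fintype (Coef n j)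
  | 0 => inferInstanceAs (Fintype n)
  | j + 1 => haveI := instFintypeCoef j; inferInstanceAs (Fintype (n × Coef n j))

/-- `Out m n j` is a finite type. [cite: Khot2005, §6.2] -/
instance instFintypeOut [Fintype m] [Fintype n] : (j : ℕ) → Fintype (Out m n j)
  | 0 => inferInstanceAs (Fintype m)
  | j + 1 => haveI := instFintypeOut j
      inferInstanceAs (Fintype ((m × Coef n j) ⊕ (m × Out m n j)))

/-- The `(j+1)`-fold tensor power `x^{⊗(j+1)}` of a coefficient vector `x ∈ ℤⁿ`, as a
coefficient vector of level `j` (Khot 2005, §7.1: "`x^{⊗j}` serves as a nonzero coefficient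
vector for the lattice `L_j(B_j)`"). [cite: Khot2005, §7.1] -/
def tpow (x : n → ℤ) : (j : ℕ) → (Coef n j → ℤ)
  | 0 => x
  | j + 1 => fun p : n × Coef n j => x p.1 * tpow x j p.2

/-- `tpow x 0 = x`. [cite: Khot2005, §7.1] -/
@[simp] theorem tpow_zero (x : n → ℤ) : tpow x 0 = x := rfl

/-- `x^{⊗(j+2)} (i, c) = xᵢ · x^{⊗(j+1)} c`. [cite: Khot2005, §7.1] -/
@[simp] theorem tpow_succ_apply (x : n → ℤ) (j : ℕ) (i : n) (c : Coef n j) :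
    tpow x (j + 1) (i, c) = x i * tpow x j c := rfl

/-- A tensor power of a nonzero vector is nonzero. [cite: Khot2005, §7.1] -/
theorem tpow_ne_zero {x : n → ℤ} (hx : x ≠ 0) : ∀ j : ℕ, tpow x j ≠ 0
  | 0 => hx
  | j + 1 => by
    obtain ⟨i, hi⟩ := Function.ne_iff.1 hx
    obtain ⟨c, hc⟩ := Function.ne_iff.1 (tpow_ne_zero hx j)
    exact Function.ne_iff.2 ⟨(i, c), mul_ne_zero hi hc⟩

variable [Fintype n]

/-- **Khot's augmented tensor powers, integrally rescaled.** For an integer basis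
`B ∈ ℤ^{m × n}` (lattice `L = L(B) = {Bx}`, Khot's column convention) and an integer `W ≠ 0`,
`augPow B W j : ℤ^{Coef n j} → ℤ^{Out m n j}` is the basis map of the lattice `W · L_{j+1}`,
where `L_1 = L` and `L_{j+1} = L ⊗_{αA} L_j` is Khot's augmented tensor product with parameter
`α = 1/W` (§6.2: basis `B ⊗ [αI ; B_j]`, vectors `αBx_1 ∘ ⋯ ∘ αBx_{N'} ∘ BxB_jᵀ`; §7, Eq. (2),
where `α = 1/d^{10k}`). Indeed `W · L_1 = L(W B)` and
`W · (αBx_1 ∘ ⋯ ∘ αBx_{N'} ∘ BxB_jᵀ) = Bx_1 ∘ ⋯ ∘ Bx_{N'} ∘ Bx(W B_j)ᵀ`, so level `j+1` is: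
the matrix `Bx` itself (side block), followed by the rows of `Bx` pushed through level `j`
(main block). Rescaling by `W = 1/α` makes every lattice integral and multiplies all norms by
the common factor `W`, so gap statements are unchanged. [cite: Khot2005, §6.2 and §7 Eq. (2)] -/
def augPow (B : Matrix m n ℤ) (W : ℤ) : (j : ℕ) → (Coef n j → ℤ) → (Out m n j → ℤ)
  | 0, x => W • B *ᵥ x
  | j + 1, X => Sum.elim
      (fun p : m × Coef n j => (B * Matrix.of fun i c => X (i, c)) p.1 p.2)
      (fun p : m × Out m n j => augPow B W j ((B * Matrix.of fun i c => X (i, c)) p.1) p.2)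

/-- **The NO-structure of Khot's basic SVP instances** (Thm. 5.1 (3); the hypothesis of §7.2),
Euclidean case `p = 2`: every nonzero lattice vector `Bx` either has a coordinate of magnitude
at least `D` (printed: `d^{20k}`), or has at least `d` nonzero coordinates, or has all
coordinates even and at least `d/2^p = d/4` of them nonzero (rendered exactly as
`d ≤ 4 · #{nonzero coordinates}`; the number of nonzero coordinates is Mathlib's
`hammingNorm`). [cite: Khot2005, Thm. 5.1 (3) and §7.2] -/
def NoStructure [Fintype m] (B : Matrix m n ℤ) (d D : ℕ) : Prop :=
  ∀ x : n → ℤ, x ≠ 0 →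
    (∃ i, (D : ℤ) ≤ |(B *ᵥ x) i|) ∨ d ≤ hammingNorm (B *ᵥ x) ∨
      ((∀ i, Even ((B *ᵥ x) i)) ∧ d ≤ 4 * hammingNorm (B *ᵥ x))

end Defs

/-! #### Unfolding, linearity, injectivity -/

section Linear

variable {m n : Type} [Fintype n]

/-- Level `0` of `augPow` is `x ↦ W · Bx`. [cite: Khot2005, §7 Eq. (2)] -/
@[simp] theorem augPow_zero (B : Matrix m n ℤ) (W : ℤ) (x : n → ℤ) :
    augPow B W 0 x = W • B *ᵥ x := rfl

/-- Level `j+1` of `augPow`: side block `Bx`, main block the rows of `Bx` through level `j`.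
[cite: Khot2005, §6.2] -/
theorem augPow_succ (B : Matrix m n ℤ) (W : ℤ) (j : ℕ) (X : Coef n (j + 1) → ℤ) :
    augPow B W (j + 1) X = Sum.elim
      (fun p : m × Coef n j => (B * Matrix.of fun i c => X (i, c)) p.1 p.2)
      (fun p : m × Out m n j => augPow B W j ((B * Matrix.of fun i c => X (i, c)) p.1) p.2) :=
  rfl

/-- `augPow B W j` is homogeneous (it is `ℤ`-linear; homogeneity is what §7 uses).
[cite: Khot2005, §6.2] -/
theorem augPow_smul (B : Matrix m n ℤ) (W c : ℤ) :
    ∀ (j : ℕ) (X : Coef n j → ℤ), augPow B W j (c • X) = c • augPow B W j X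
  | 0, x => by
    rw [augPow_zero, augPow_zero, Matrix.mulVec_smul, smul_comm]
  | j + 1, X => by
    have hX : (Matrix.of fun i c' => (c • X) (i, c')) = c • Matrix.of fun i c' => X (i, c') := by
      ext i c'
      rfl
    rw [augPow_succ, augPow_succ, hX, Matrix.mul_smul]
    funext p
    rcases p with p | p
    · rfl
    · show augPow B W j (c • (B * Matrix.of fun i c' => X (i, c')) p.1) p.2 =
        c * augPow B W j ((B * Matrix.of fun i c' => X (i, c')) p.1) p.2
      rw [augPow_smul]
      rfl

/-- A column of the matrix `B · x` at level `j+1` is `B` applied to the corresponding column of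
the coefficient matrix `x`. [cite: Khot2005, §6.2] -/
theorem mul_of_col (B : Matrix m n ℤ) {j : ℕ} (X : Coef n (j + 1) → ℤ) (c : Coef n j) :
    (fun r => (B * Matrix.of fun i c' => X (i, c')) r c) = B *ᵥ fun i => X (i, c) := by
  funext r
  simp [Matrix.mul_apply, Matrix.mulVec, dotProduct]

/-- If the columns of `B` are linearly independent (`Bx = 0 → x = 0`, Khot's standing assumption,
§1.3) and `W ≠ 0`, every level `augPow B W j` is injective. [cite: Khot2005, §1.3 and §6.2] -/
theorem augPow_eq_zero {B : Matrix m n ℤ} (hB : ∀ x, B *ᵥ x = 0 → x = 0) {W : ℤ} (hW : W ≠ 0) :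
    ∀ (j : ℕ) (X : Coef n j → ℤ), augPow B W j X = 0 → X = 0
  | 0, x, h => hB x ((smul_eq_zero.1 h).resolve_left hW)
  | j + 1, X, h => by
    rw [augPow_succ] at h
    funext p
    obtain ⟨i, c⟩ := p
    have hcol : B *ᵥ (fun i' => X (i', c)) = 0 := by
      rw [← mul_of_col]
      funext r
      exact congrFun h (Sum.inl (r, c))
    exact congrFun (hB _ hcol) i

/-- At level `j+1`, the tensor power `x^{⊗(j+2)}` is mapped to `(Bx)_r · x^{⊗(j+1)}_c` (side
block) and `(Bx)_r · (W B_{j+1} x^{⊗(j+1)})_o` (main block) — Khot 2005, §7.1: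
"`B_j (x ⊗ x^{⊗(j-1)})`". [cite: Khot2005, §7.1 (proof of Lemma 7.1)] -/
theorem augPow_tpow_succ (B : Matrix m n ℤ) (W : ℤ) (x : n → ℤ) (j : ℕ) :
    augPow B W (j + 1) (tpow x (j + 1)) = Sum.elim
      (fun p : m × Coef n j => (B *ᵥ x) p.1 * tpow x j p.2)
      (fun p : m × Out m n j => (B *ᵥ x) p.1 * augPow B W j (tpow x j) p.2) := by
  have hmat : (B * Matrix.of fun i c => tpow x (j + 1) (i, c)) =
      Matrix.of fun r c => (B *ᵥ x) r * tpow x j c := by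
    ext r c
    simp only [Matrix.mul_apply, Matrix.of_apply, tpow_succ_apply, Matrix.mulVec, dotProduct,
      sum_mul]
    exact sum_congr rfl fun i _ => by ring
  rw [augPow_succ, hmat]
  congr 1
  funext p
  rw [show (Matrix.of fun r c => (B *ᵥ x) r * tpow x j c) p.1 = (B *ᵥ x) p.1 • tpow x j from rfl,
    augPow_smul]
  rfl

end Linear

/-! #### Squared norms through one level -/

section Norms

variable {m n : Type} [Fintype m] [Fintype n]

/-- The squared norm at level `j+1` splits as side block plus the rows of `Bx` through level `j`
(Khot 2005, §7.2, display (3) for `p = 2`). [cite: Khot2005, §7.2 Eq. (3)] -/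
theorem intSqNorm_augPow_succ (B : Matrix m n ℤ) (W : ℤ) (j : ℕ) (X : Coef n (j + 1) → ℤ) :
    intSqNorm (augPow B W (j + 1) X) =
      intSqNorm (fun p : m × Coef n j => (B * Matrix.of fun i c => X (i, c)) p.1 p.2) +
        ∑ r, intSqNorm (augPow B W j ((B * Matrix.of fun i c => X (i, c)) r)) := by
  rw [augPow_succ, intSqNorm_sum_elim]
  congr 1
  exact intSqNorm_prod _

/-- `‖x^{⊗(j+1)}‖² = ‖x‖^{2(j+1)}` (Khot 2005, §7.1: "`‖x^{⊗j}‖ₚᵖ = ‖x‖ₚ^{pj}`").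
[cite: Khot2005, §7.1] -/
theorem intSqNorm_tpow (x : n → ℤ) : ∀ j : ℕ, intSqNorm (tpow x j) = intSqNorm x ^ (j + 1)
  | 0 => (pow_one _).symm
  | j + 1 => by
    rw [show tpow x (j + 1) = fun p : n × Coef n j => x p.1 * tpow x j p.2 from rfl,
      intSqNorm_outer, intSqNorm_tpow x j, ← pow_succ']

/-- The identity of the proof of Lemma 7.1 for `p = 2`, rescaled by `W`:
`‖W B_{j+2} x^{⊗(j+2)}‖² = ‖Bx‖² · (‖x^{⊗(j+1)}‖² + ‖W B_{j+1} x^{⊗(j+1)}‖²)` (printed: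
`‖B_j x^{⊗j}‖ₚᵖ = ‖Bx‖ₚᵖ · (αᵖ ‖x^{⊗(j-1)}‖ₚᵖ + ‖B_{j-1} x^{⊗(j-1)}‖ₚᵖ)`).
[cite: Khot2005, Lemma 7.1 (proof)] -/
theorem intSqNorm_augPow_tpow_succ (B : Matrix m n ℤ) (W : ℤ) (x : n → ℤ) (j : ℕ) :
    intSqNorm (augPow B W (j + 1) (tpow x (j + 1))) =
      intSqNorm (B *ᵥ x) * (intSqNorm x ^ (j + 1) + intSqNorm (augPow B W j (tpow x j))) := by
  rw [augPow_tpow_succ, intSqNorm_sum_elim, intSqNorm_outer, intSqNorm_outer, intSqNorm_tpow,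
    mul_add]

/-! #### Lemma 7.1 (the YES case) -/

/-- **Khot 2005, Lemma 7.1 (YES case of the boosting), Euclidean norm, integrally rescaled.**
If `‖Bx‖² ≤ g` and `‖x‖² ≤ s` (printed: `‖Bx‖ₚᵖ ≤ γd`, `‖x‖ₚᵖ ≤ d^{10p}`, Thm. 5.1 (2)) and
`s^k ≤ W²` (printed: `α = 1/d^{10k}`, so `αᵖ ‖x^{⊗(j-1)}‖ₚᵖ ≤ 1`), then for every level `j ≤ k`,
`‖W B_{j+1} x^{⊗(j+1)}‖² ≤ W² · ∑_{l=1}^{j+1} g^l` — "for `1 ≤ j ≤ k`,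
`‖B_j x^{⊗j}‖ₚᵖ ≤ ∑_{l=1}^{j} γ^l d^l`". [cite: Khot2005, Lemma 7.1] -/
theorem intSqNorm_augPow_tpow_le (B : Matrix m n ℤ) {W g s : ℤ} {x : n → ℤ}
    (hg : intSqNorm (B *ᵥ x) ≤ g) (hs : intSqNorm x ≤ s) (k : ℕ) (hsW : s ^ k ≤ W ^ 2) :
    ∀ j ≤ k, intSqNorm (augPow B W j (tpow x j)) ≤ W ^ 2 * ∑ l ∈ range (j + 1), g ^ (l + 1)
  | 0, _ => by
    rw [tpow_zero, augPow_zero, intSqNorm_smul, sum_range_one, zero_add, pow_one]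
    have h0 : 0 ≤ W ^ 2 := sq_nonneg W
    exact mul_le_mul_of_nonneg_left hg h0
  | j + 1, hj => by
    have IH := intSqNorm_augPow_tpow_le B hg hs k hsW j (Nat.le_of_succ_le hj)
    have hx0 : 0 ≤ intSqNorm x := intSqNorm_nonneg x
    have hBx0 : 0 ≤ intSqNorm (B *ᵥ x) := intSqNorm_nonneg _
    have hg0 : 0 ≤ g := hBx0.trans hg
    have hs0 : 0 ≤ s := hx0.trans hs
    have hP0 : 0 ≤ intSqNorm (augPow B W j (tpow x j)) := intSqNorm_nonneg _
    have hsj : s ^ (j + 1) ≤ W ^ 2 := by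
      rcases eq_or_lt_of_le hs0 with h | h
      · rw [← h, zero_pow (Nat.succ_ne_zero j)]
        exact sq_nonneg W
      · exact (pow_le_pow_right₀ (show (1 : ℤ) ≤ s by omega) hj).trans hsW
    have hxs : intSqNorm x ^ (j + 1) ≤ s ^ (j + 1) := pow_le_pow_left₀ hx0 hs (j + 1)
    have hsum : g * (W ^ 2 * ∑ l ∈ range (j + 1), g ^ (l + 1)) =
        W ^ 2 * ∑ l ∈ range (j + 1), g ^ (l + 1 + 1) := by
      rw [mul_sum, mul_sum, mul_sum]
      exact sum_congr rfl fun l _ => by ring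
    rw [intSqNorm_augPow_tpow_succ]
    calc intSqNorm (B *ᵥ x) * (intSqNorm x ^ (j + 1) + intSqNorm (augPow B W j (tpow x j)))
        ≤ g * (s ^ (j + 1) + W ^ 2 * ∑ l ∈ range (j + 1), g ^ (l + 1)) :=
          mul_le_mul hg (add_le_add hxs IH) (by positivity) hg0
      _ ≤ g * (W ^ 2 + W ^ 2 * ∑ l ∈ range (j + 1), g ^ (l + 1)) := by gcongr
      _ = W ^ 2 * ∑ l ∈ range (j + 1 + 1), g ^ (l + 1) := by
          rw [sum_range_succ' _ (j + 1), mul_add g, hsum, zero_add, pow_one, mul_add]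
          ring

/-- The geometric bound behind Khot's "`(2γᵏdᵏ)^{1/p}`" (Lemma 7.1, second sentence): for `g ≥ 2`,
`∑_{l=1}^{j+1} g^l ≤ 2 g^{j+1}`. [cite: Khot2005, Lemma 7.1] -/
theorem sum_pow_le_two_mul_pow {g : ℤ} (hg : 2 ≤ g) :
    ∀ j : ℕ, ∑ l ∈ range (j + 1), g ^ (l + 1) ≤ 2 * g ^ (j + 1)
  | 0 => by
    rw [sum_range_one, zero_add, pow_one]
    linarith
  | j + 1 => by
    have IH := sum_pow_le_two_mul_pow hg j
    have hgj : 0 ≤ g ^ (j + 1) := by positivity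
    rw [sum_range_succ]
    calc ∑ l ∈ range (j + 1), g ^ (l + 1) + g ^ (j + 1 + 1)
        ≤ 2 * g ^ (j + 1) + g ^ (j + 1 + 1) := by gcongr
      _ ≤ g * g ^ (j + 1) + g ^ (j + 1 + 1) := by gcongr
      _ = 2 * g ^ (j + 1 + 1) := by ring

/-- **Khot 2005, Lemma 7.1, second sentence / §7.3 (YES side of the gap), `p = 2`, rescaled.**
If the basic instance has a nonzero coefficient vector `x` with `‖x‖² ≤ s`, `‖Bx‖² ≤ g`
(Thm. 5.1 (2)), `g ≥ 2`, and `s^k ≤ W²`, then for every level `j ≤ k` the lattice `W · L_{j+1}`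
has the NONZERO vector `W B_{j+1} x^{⊗(j+1)}` of squared norm at most `2 W² g^{j+1}` — "the
lattice `L_k` has a nonzero lattice vector of length `(2γᵏdᵏ)^{1/p}`, namely `B_k x^{⊗k}`".
(Nonzero by injectivity, `augPow_eq_zero`, for `B` with independent columns.)
[cite: Khot2005, Lemma 7.1 and §7.3] -/
theorem short_vector_of_yes {B : Matrix m n ℤ} (hB : ∀ x, B *ᵥ x = 0 → x = 0)
    {W g s : ℤ} (hW : W ≠ 0) (hg2 : 2 ≤ g) {x : n → ℤ} (hx : x ≠ 0) (hs : intSqNorm x ≤ s)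
    (hg : intSqNorm (B *ᵥ x) ≤ g) (k : ℕ) (hsW : s ^ k ≤ W ^ 2) (j : ℕ) (hj : j ≤ k) :
    augPow B W j (tpow x j) ≠ 0 ∧ intSqNorm (augPow B W j (tpow x j)) ≤ 2 * W ^ 2 * g ^ (j + 1) := by
  refine ⟨fun h => tpow_ne_zero hx j (augPow_eq_zero hB hW j _ h), ?_⟩
  calc intSqNorm (augPow B W j (tpow x j)) ≤ W ^ 2 * ∑ l ∈ range (j + 1), g ^ (l + 1) :=
        intSqNorm_augPow_tpow_le B hg hs k hsW j hj
    _ ≤ W ^ 2 * (2 * g ^ (j + 1)) :=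
        mul_le_mul_of_nonneg_left (sum_pow_le_two_mul_pow hg2 j) (sq_nonneg W)
    _ = 2 * W ^ 2 * g ^ (j + 1) := by ring

/-! #### Lemma 7.2 (the NO case) -/

/-- **Khot 2005, Lemma 7.2 (NO case of the boosting), Euclidean norm, integrally rescaled.**
Let `B ∈ ℤ^{m×n}` have linearly independent columns and the NO-structure of Thm. 5.1 (3) with
parameters `d, D` (`NoStructure B d D`), and let `W ≠ 0`. Then for every level `j` with
`W² d^{j+1} ≤ D²` (printed: `αᵖ d^{20kp} ≥ d^{kp} ≥ dʲ` with `α = 1/W = d^{-10k}`,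
`D = d^{20k}`, `j ≤ k`), every nonzero vector of `W · L_{j+1}` has squared norm at least
`W² d^{j+1}` — "the length of any nonzero vector in the lattice `L_j` is at least `d^{j/p}`. In
particular, the length of the shortest vector in the lattice `L_k` is at least `d^{k/p}`".
Proof as printed (induction on `j`; Case 1: a coordinate of magnitude `≥ D` in the side block;
Case 2: a column of `X = Bx` with `≥ d` nonzero coordinates gives `≥ d` nonzero rows, each of
squared norm `≥ W² dʲ` through the previous level; Case 3: all entries even and a column with
`≥ d/4` nonzero coordinates gives `≥ d/4` nonzero even rows `2r_l`, each contributing `4 W² dʲ`).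
[cite: Khot2005, Lemma 7.2] -/
theorem le_intSqNorm_augPow {B : Matrix m n ℤ} (hB : ∀ x, B *ᵥ x = 0 → x = 0) {d D : ℕ}
    (hNO : NoStructure B d D) {W : ℤ} (hW : W ≠ 0) :
    ∀ j : ℕ, W ^ 2 * (d : ℤ) ^ (j + 1) ≤ (D : ℤ) ^ 2 →
      ∀ X : Coef n j → ℤ, X ≠ 0 → W ^ 2 * (d : ℤ) ^ (j + 1) ≤ intSqNorm (augPow B W j X)
  | 0, hD, x, hx => by
    rw [augPow_zero, intSqNorm_smul, zero_add, pow_one]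
    rw [zero_add, pow_one] at hD
    have hW1 : 1 ≤ W ^ 2 := (one_le_sq_iff_one_le_abs _).2 (Int.one_le_abs hW)
    refine mul_le_mul_of_nonneg_left ?_ (sq_nonneg W)
    rcases hNO x hx with ⟨i, hi⟩ | hd | ⟨heven, hd⟩
    · have hdD : (d : ℤ) ≤ (D : ℤ) ^ 2 := by nlinarith [hD, Nat.cast_nonneg (α := ℤ) d]
      calc (d : ℤ) ≤ (D : ℤ) ^ 2 := hdD
        _ ≤ |(B *ᵥ x) i| ^ 2 := pow_le_pow_left₀ (Nat.cast_nonneg D) hi 2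
        _ = (B *ᵥ x) i ^ 2 := sq_abs _
        _ ≤ intSqNorm (B *ᵥ x) := sq_le_intSqNorm _ i
    · exact (Nat.cast_le.2 hd).trans (hammingNorm_le_intSqNorm _)
    · calc (d : ℤ) ≤ 4 * (hammingNorm (B *ᵥ x) : ℤ) := by exact_mod_cast hd
        _ ≤ intSqNorm (B *ᵥ x) := four_mul_hammingNorm_le_intSqNorm _ heven
  | j + 1, hD, X, hX => by
    classical
    -- the matrix `Y = B x` and the splitting of the squared norm
    set Y : Matrix m (Coef n j) ℤ := B * Matrix.of fun i c => X (i, c) with hYdef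
    rw [intSqNorm_augPow_succ, ← hYdef]
    have hside_nn : 0 ≤ intSqNorm (fun p : m × Coef n j => Y p.1 p.2) := intSqNorm_nonneg _
    -- degenerate parameter `d = 0`
    rcases Nat.eq_zero_or_pos d with rfl | hdpos
    · rw [Nat.cast_zero, zero_pow (Nat.succ_ne_zero _), mul_zero]
      exact add_nonneg hside_nn (sum_nonneg fun r _ => intSqNorm_nonneg _)
    -- induction hypothesis at level `j`
    have hdd : W ^ 2 * (d : ℤ) ^ (j + 1) ≤ W ^ 2 * (d : ℤ) ^ (j + 1 + 1) :=
      mul_le_mul_of_nonneg_left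
        (pow_le_pow_right₀ (by exact_mod_cast hdpos) (Nat.le_succ _)) (sq_nonneg W)
    have hIH : ∀ Z : Coef n j → ℤ, Z ≠ 0 → W ^ 2 * (d : ℤ) ^ (j + 1) ≤ intSqNorm (augPow B W j Z) :=
      le_intSqNorm_augPow hB hNO hW j (hdd.trans hD)
    have hpos : 0 ≤ W ^ 2 * (d : ℤ) ^ (j + 1) := by positivity
    -- columns of `Y` are `B` applied to the columns of `X`
    have hcol : ∀ c, (fun r => Y r c) = B *ᵥ fun i => X (i, c) := fun c => mul_of_col B X c
    -- `Y ≠ 0`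
    have hY0 : ∃ c, (fun r => Y r c) ≠ 0 := by
      by_contra hall
      push Not at hall
      apply hX
      funext p
      obtain ⟨i, c⟩ := p
      exact congrFun (hB _ ((hcol c).symm.trans (hall c))) i
    -- nonzero rows: each contributes `W² d^{j+1}` to the main block
    have hrows : ∀ (t : m → Coef n j → ℤ) (R : Finset m), (∀ r ∈ R, t r ≠ 0) →
        (R.card : ℤ) * (W ^ 2 * (d : ℤ) ^ (j + 1)) ≤ ∑ r, intSqNorm (augPow B W j (t r)) := by
      intro t R hR
      calc (R.card : ℤ) * (W ^ 2 * (d : ℤ) ^ (j + 1))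
          = ∑ _r ∈ R, W ^ 2 * (d : ℤ) ^ (j + 1) := by rw [sum_const, nsmul_eq_mul]
        _ ≤ ∑ r ∈ R, intSqNorm (augPow B W j (t r)) := sum_le_sum fun r hr => hIH _ (hR r hr)
        _ ≤ ∑ r, intSqNorm (augPow B W j (t r)) :=
          sum_le_sum_of_subset_of_nonneg (subset_univ _) fun r _ _ => intSqNorm_nonneg _
    -- Case 1: an entry of magnitude `≥ D` in the side block
    by_cases hbig : ∃ r c, (D : ℤ) ≤ |Y r c|
    · obtain ⟨r, c, hrc⟩ := hbig
      have h1 : (D : ℤ) ^ 2 ≤ intSqNorm (fun p : m × Coef n j => Y p.1 p.2) :=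
        calc (D : ℤ) ^ 2 ≤ |Y r c| ^ 2 := pow_le_pow_left₀ (Nat.cast_nonneg D) hrc 2
          _ = (fun p : m × Coef n j => Y p.1 p.2) (r, c) ^ 2 := sq_abs _
          _ ≤ _ := sq_le_intSqNorm _ (r, c)
      have h2 : 0 ≤ ∑ r, intSqNorm (augPow B W j (Y r)) := sum_nonneg fun r _ => intSqNorm_nonneg _
      linarith
    push Not at hbig
    -- every nonzero column: `≥ d` nonzero entries, or all even with `≥ d/4` nonzero entries
    have hcolNO : ∀ c, (fun r => Y r c) ≠ 0 →
        d ≤ hammingNorm (fun r => Y r c) ∨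
          ((∀ r, Even (Y r c)) ∧ d ≤ 4 * hammingNorm (fun r => Y r c)) := by
      intro c hc
      have hxc : (fun i => X (i, c)) ≠ 0 := by
        intro h0
        apply hc
        rw [hcol c, h0, Matrix.mulVec_zero]
      rcases hNO _ hxc with ⟨i, hi⟩ | h2 | h3
      · rw [← hcol c] at hi
        exact absurd hi (not_le.2 (hbig i c))
      · rw [← hcol c] at h2
        exact Or.inl h2
      · rw [← hcol c] at h3
        exact Or.inr h3
    have hrow_ne : ∀ c r, Y r c ≠ 0 → Y r ≠ 0 := fun c r h h0 => h (by rw [h0]; rfl)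
    -- Case 2: a column with `≥ d` nonzero entries
    by_cases h2 : ∃ c, d ≤ hammingNorm (fun r => Y r c)
    · obtain ⟨c, hc⟩ := h2
      have key := hrows Y (univ.filter fun r => Y r c ≠ 0) fun r hr => hrow_ne c r (mem_filter.1 hr).2
      have hcard : (d : ℤ) ≤ ((univ.filter fun r => Y r c ≠ 0).card : ℤ) := by exact_mod_cast hc
      calc W ^ 2 * (d : ℤ) ^ (j + 1 + 1) = (d : ℤ) * (W ^ 2 * (d : ℤ) ^ (j + 1)) := by ring
        _ ≤ ((univ.filter fun r => Y r c ≠ 0).card : ℤ) * (W ^ 2 * (d : ℤ) ^ (j + 1)) :=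
            mul_le_mul_of_nonneg_right hcard hpos
        _ ≤ ∑ r, intSqNorm (augPow B W j (Y r)) := key
        _ ≤ _ := le_add_of_nonneg_left hside_nn
    push Not at h2
    -- Case 3: all entries of `Y` are even, and some column has `≥ d/4` nonzero entries
    have heven : ∀ r c, Even (Y r c) := by
      intro r c
      by_cases hc : (fun r => Y r c) = 0
      · rw [show Y r c = 0 from congrFun hc r]
        exact ⟨0, rfl⟩
      · rcases hcolNO c hc with h | ⟨h, -⟩
        · exact absurd h (not_le.2 (h2 c))
        · exact h r
    obtain ⟨c0, hc0⟩ := hY0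
    have h4 : d ≤ 4 * hammingNorm (fun r => Y r c0) := by
      rcases hcolNO c0 hc0 with h | ⟨-, h⟩
      · exact absurd h (not_le.2 (h2 c0))
      · exact h
    choose t ht using heven
    have hYt : ∀ r, Y r = (2 : ℤ) • fun c => t r c := fun r => funext fun c => by
      rw [Pi.smul_apply, smul_eq_mul, two_mul]
      exact ht r c
    have ht_ne : ∀ r, Y r c0 ≠ 0 → (fun c => t r c) ≠ 0 := by
      intro r hr h0
      apply hr
      rw [ht r c0, show t r c0 = 0 from congrFun h0 c0, add_zero]
    have hmain : ∑ r, intSqNorm (augPow B W j (Y r)) =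
        4 * ∑ r, intSqNorm (augPow B W j fun c => t r c) := by
      rw [mul_sum]
      refine sum_congr rfl fun r _ => ?_
      rw [hYt r, augPow_smul, intSqNorm_smul]
      norm_num
    have key := hrows t (univ.filter fun r => Y r c0 ≠ 0) fun r hr => ht_ne r (mem_filter.1 hr).2
    have hcard : (d : ℤ) ≤ 4 * ((univ.filter fun r => Y r c0 ≠ 0).card : ℤ) := by
      exact_mod_cast h4
    calc W ^ 2 * (d : ℤ) ^ (j + 1 + 1) = (d : ℤ) * (W ^ 2 * (d : ℤ) ^ (j + 1)) := by ring
      _ ≤ (4 * ((univ.filter fun r => Y r c0 ≠ 0).card : ℤ)) * (W ^ 2 * (d : ℤ) ^ (j + 1)) :=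
          mul_le_mul_of_nonneg_right hcard hpos
      _ = 4 * (((univ.filter fun r => Y r c0 ≠ 0).card : ℤ) * (W ^ 2 * (d : ℤ) ^ (j + 1))) := by
          ring
      _ ≤ 4 * ∑ r, intSqNorm (augPow B W j fun c => t r c) :=
          mul_le_mul_of_nonneg_left key (by norm_num)
      _ = ∑ r, intSqNorm (augPow B W j (Y r)) := hmain.symm
      _ ≤ _ := le_add_of_nonneg_left hside_nn

/-- **Khot 2005, §7.3 (the gap of the boosted instance), `p = 2`, rescaled by `W`.** Under the
NO-structure every nonzero vector of `W · L_{k+1}` has squared norm `≥ W² d^{k+1}`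
(`le_intSqNorm_augPow`), while under the YES data some nonzero vector has squared norm
`≤ 2 W² g^{k+1}` (`short_vector_of_yes`): the ratio of squared lengths is
`d^{k+1} / (2 g^{k+1}) = (1/2) (d/g)^{k+1}`, i.e. "`L_k` is a gap instance of SVP with gap
`(1/(2γᵏ))^{1/p} = 2^{Ω(k)}`" for `γ = g/d < 1`. This corollary records the two bounds side by
side for a common level `k` and common parameters. [cite: Khot2005, §7.3] -/
theorem boosted_gap {B : Matrix m n ℤ} (hB : ∀ x, B *ᵥ x = 0 → x = 0) {d D : ℕ} {W g s : ℤ}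
    (hW : W ≠ 0) (k : ℕ) (hsW : s ^ k ≤ W ^ 2) (hD : W ^ 2 * (d : ℤ) ^ (k + 1) ≤ (D : ℤ) ^ 2)
    (hg2 : 2 ≤ g) :
    ((∃ x : n → ℤ, x ≠ 0 ∧ intSqNorm x ≤ s ∧ intSqNorm (B *ᵥ x) ≤ g) →
        ∃ X : Coef n k → ℤ, augPow B W k X ≠ 0 ∧
          intSqNorm (augPow B W k X) ≤ 2 * W ^ 2 * g ^ (k + 1)) ∧
      (NoStructure B d D →
        ∀ X : Coef n k → ℤ, X ≠ 0 → W ^ 2 * (d : ℤ) ^ (k + 1) ≤ intSqNorm (augPow B W k X)) :=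
  ⟨fun ⟨_, hx, hs, hg⟩ => ⟨_, short_vector_of_yes hB hW hg2 hx hs hg k hsW k le_rfl⟩,
    fun hNO => le_intSqNorm_augPow hB hNO hW k hD⟩

end Norms

end Khot

end Literature.Algebra.EuclideanLattices
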